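import Summits.CriticalPhenomena.PercolationContinuityZ3.Theorems.PercNearOneGluingNoHeavyLowerTailSahiTransportJRData4

/-!
# `NoHeavyLowerTail` (crux stmt-CriticalPhenomena-4575), Sahi / Kahn positivity: parameter-free transport certificates on `2^4` — evaluation F

Support file (cell `prim-l12`, seat P3, gen 5; `--supports stmt-CriticalPhenomena-4575`).  Computational (`native_decide`): the digit test
`SahiTransportJR.checkTab 33 4 M (certTab4 M)` — structure of the table, every capacity row and all `14 196` transport rows `X ≤ Z` over the `168`
increasing bitmasks of `2^4`, each a `256`-digit base-`2^33` Kronecker-number test — passes for the 23 nontrivial increasing pattern events `M` of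
batch F (`batch4F`).  Six batches A–F cover the `163` events of `2^4` outside the `K₂,₂` orbit; with `…SahiTransportJRSound.sahiE_three_nonneg_of_checkTab`
each gives Kahn's Conjecture 5 / Sahi's `C₃` for that junta first slot, the other two increasing events arbitrary, every dimension. [this work]
-/

namespace Summit.CriticalPhenomena.PercolationContinuityZ3.Theorems.SahiTransportJR

/-- Batch F of certified pattern events of `2^4` (bitmasks over the `16` points). [this work] -/
def batch4F : List ℕ := [65272, 65274, 65276, 65278, 65280, 65408, 65416, 65440, 65448, 65450, 65472, 65480, 65484, 65504, 65512, 65514, 65516, 65518, 65520, 65528, 65530, 65532, 65534]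

/-- Every event of batch F passes the certificate check (kernel evaluation via `native_decide`). [this work] -/
theorem checkTab4_batchF : (batch4F.all fun M => checkTab 33 4 M (certTab4 M)) = true := by native_decide

/-- Pointwise form. [this work] -/
theorem checkTab4_of_mem_batchF {M : ℕ} (h : M ∈ batch4F) : checkTab 33 4 M (certTab4 M) = true :=
  List.all_eq_true.1 checkTab4_batchF M h

end Summit.CriticalPhenomena.PercolationContinuityZ3.Theorems.SahiTransportJR
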